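import Literature.Analysis.FluidPDE.ForwardDSSExistence
import Literature.Analysis.FluidPDE.ForwardDSSExtension
import Literature.Analysis.FluidPDE.SelfSimilarProofs
import Literature.Analysis.UnboundedOperators.HeatKernelHeatEquation
import HarnessLib

/-!
# Forward DSS local Leray solutions: the architecture of Bradshaw–Tsai 2017 ([BT1]), Thm 1.2

Analysis/FluidPDE fact file, companion of `ForwardDSSExistence.lean`, whose named fact
`Literature.Analysis.FluidPDE.bradshawTsai2017_dss_localLeray_existence` renders

> **Bradshaw–Tsai, Ann. Henri Poincaré 18 (2017), Theorem 1.2.** Let `v₀` be a divergence free,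
> `λ`-DSS vector field for some `λ > 1` and satisfy `‖v₀‖_{L³_w(ℝ³)} ≤ c₀` for a possibly large
> constant `c₀`. Then, there exists a local Leray solution `v` to (NSE) which is `λ`-DSS and
> additionally satisfies `‖v(t) − e^{tΔ}v₀‖_{L²(ℝ³)} ≤ C₀ t^{1/4}` for any `t ∈ (0,∞)` and a
> constant `C₀ = C₀(v₀)`

(the `t^{1/4}` estimate being omitted there). Discharging it needs a weak-solution theory of the
Navier–Stokes equations (Galerkin approximation of the time-periodic Leray system, compactness,
Calderón–Zygmund estimates for the pressure) which neither Mathlib nor `Literature` has. This file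
records the **printed proof's architecture** (loc. cit. §2–§4) as two named facts and **proves the
assembly** (`bradshawTsai2017_dss_localLeray_existence_of_parts`), so that the trust base of
[BT1, Thm 1.2] in the tree is split into independently attackable, precisely cited pieces: the
core PDE construction (§2 with Lemma 3.4) and the elementary verification of the local Leray
axioms (§4), the latter being dischargeable from heat-semigroup estimates.

## The printed proof

[BT1] work in the similarity variables `y = x/√(2t)`, `s = log √(2t)` (§1): `λ`-DSS solutions
`v` correspond to profiles `u(y,s) = √(2t) v(x,t)` which are time periodic with period
`T = log λ` and solve the time-dependent Leray system (§1; (2.1)). Given a `T`-periodic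
divergence free profile `U₀` subject to **Assumption 2.1** (`C¹`, `LU₀ = 0`,
`U₀ ∈ L^∞(0,T; L⁴ ∩ L^q)`, decay `sup_s ‖U₀‖_{L^q(|y|>R)} ≤ Θ(R) → 0`), **Theorem 2.4** constructs
a *suitable periodic weak solution* `(u, p)` (Definitions 2.2–2.3: `u − U₀ ∈ L^∞(0,T;L²(ℝ³)) ∩
L²(0,T;H¹(ℝ³))`, the weak form of Def. 2.2, `p ∈ L^{3/2}_loc(ℝ⁴)`, distributional solution, the
local energy inequality of Def. 2.3) by a Galerkin scheme for a mollified, perturbed system (Lemmas 2.5–2.6, Brouwer's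
fixed point theorem for the period map), limits `k → ∞`, `ε → 0`, and a pressure given by Riesz
transforms with the bound `‖p_ε‖_{L^{5/3}(ℝ³×[0,T])} ≤ C‖U_ε‖²_{L^{10/3}} + C‖W‖²_{L^{10/3}}`,
whence "`p ∈ L^{5/3}(ℝ³ × [0,T])`". **Lemma 3.4** shows that `U₀(y,s) = √(2t) (e^{tΔ}v₀)(x)`
satisfies Assumption 2.1 with `T = log λ` when `v₀ ∈ L³_w` is divergence free and `λ`-DSS
(via Lemma 3.1, `L³_w = L³_loc(ℝ³∖{0})` for DSS fields, and the decay Lemma 3.2). **§4** then sets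
`v(x,t) = u(y,s)/√(2t)`, `π(x,t) = p(y,s)/(2t)`: "(v, π) is a distributional solution to (NSE)
… Note `v − e^{tΔ}v₀ ∈ L^∞(1,λ²;L²(ℝ³)) ∩ L²(1,λ²;H¹(ℝ³))`", extends these classes to `(0, λ²)`
by the `λ`-DSS scaling ("`‖v(t) − e^{tΔ}v₀‖²_{L²} ≲ t^{1/2} sup_{1≤τ≤λ²} ‖v(τ) − e^{τΔ}v₀‖²_{L²}`"),
and checks the local Leray axioms of Definition 1.1: locally finite energy and enstrophy ("noting
that `v₀ ∈ L²_uloc` implies `e^{tΔ}v₀` has uniformly locally finite energy and enstrophy"),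
convergence to the datum (the `t^{1/4}` bound and `e^{tΔ}v₀ → v₀` in `L²_loc`), decay at spatial
infinity, and the local energy inequality ("inherited from the suitability of `(u,p)`").

## Contents

* `BradshawTsai2017.IsAnsatzSolution c v₀ v π`: what §4 has in hand after its first three
  paragraphs, in the physical variables — the image `(v, π)` under the ansatz of §1 of a suitable
  periodic weak solution of the Leray system with profile `U₀ = √(2t) e^{tΔ}v₀`: `v` and `π` are
  `λ`-DSS; `(v, π)` is a CKN-suitable weak solution on the open slab `(0,∞) × ℝ³`;
  `sup_{1≤t≤λ²} ‖v(t) − e^{tΔ}v₀‖_{L²(ℝ³)} < ∞`; `∇(v − e^{tΔ}v₀) ∈ L²((1,λ²) × ℝ³)` (a weak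
  spatial gradient on the slab); `π ∈ L^{5/3}((1,λ²) × ℝ³)`.
* `bradshawTsai2017_thm_2_4` (**Thm 2.4 with Lemma 3.4**, transported to the physical variables
  by §4 ¶1–3): every divergence free `λ`-DSS `v₀ ∈ L³_w(ℝ³)` admits an `IsAnsatzSolution`.
* `bradshawTsai2017_section4` (**§4**, "We now check that `v` is a local Leray solution"): for
  such `v₀`, every `IsAnsatzSolution` pair is a local Leray solution (`IsLocalLeraySolution`, the
  tree's rendering of [BT1] Def. 1.1 = Kang–Miura–Tsai Def. 3.2).
* Proved: the **DSS covariance of the caloric extension** `e^{tΔ}(v₀)_λ = (e^{·Δ}v₀)_λ`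
  (`BradshawTsai2017.heatExtension_nsRescaleData`, the `nsRescaleData` form of the accepted
  `heatExtension_comp_inv_smul`; [BT1] proof of Lemma 3.4: "`e^{tΔ}v₀` is the divergence free,
  `λ`-DSS solution to the heat equation"); the printed **`t^{1/4}`-estimate** `‖v(t) − e^{tΔ}v₀‖²_{L²(ℝ³)} ≤ C √t` for all `t > 0` from the
  bound on `[1, λ²]` (`IsAnsatzSolution.lintegral_enorm_sub_heat_sq_le`, §4); non-vacuity of the
  predicate (`isAnsatzSolution_zero`); and the assembly
  `bradshawTsai2017_dss_localLeray_existence_of_parts`.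

## Design notes

* *Physical variables.* Theorem 2.4 is printed in the similarity variables; vendoring it verbatim
  would require renderings of Assumption 2.1 and Definitions 2.2–2.3 (weighted Leray operator,
  `H¹`/`H⁻¹` classes of profiles, the test class `𝒟_T`), none of which the tree has or needs
  elsewhere. The fact is therefore stated through its image under the explicit change of
  variables `v(x,t) = u(y,s)/√(2t)`, `π(x,t) = p(y,s)/(2t)` that §4 ¶1–3 performs in print
  (`u − U₀ ∈ L^∞(0,T;L²)` ↔
  `sup_{1≤t≤λ²} ‖v(t) − e^{tΔ}v₀‖_{L²} < ∞` since `‖v(t) − e^{tΔ}v₀(t)‖²_{L²} = √(2t) ‖U(s)‖²_{L²}`;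
  `u − U₀ ∈ L²(0,T;H¹)` ↔ `∇(v − e^{tΔ}v₀) ∈ L²((1,λ²)×ℝ³)`; `T`-periodicity of `(u,p)` ↔ `λ`-DSS of
  `(v, π)`; suitability ↔ suitability, §4 last paragraph), over the tree's
  `IsSuitableWeakSolutionOn`, `HasWeakSpatialGradientOn`, `IsDiscretelySelfSimilar`.
* *The pressure class.* Definition 1.1 requires `π ∈ L^{3/2}_loc(ℝ³ × [0,∞))` — integrability up
  to `t = 0` — which §4 does not address and which does not follow from Definition 2.3's
  `p ∈ L^{3/2}_loc(ℝ⁴)` alone; it does follow from the class `p ∈ L^{5/3}(ℝ³ × [0,T])` established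
  in the proof of Theorem 2.4 (Hölder on `(λ⁻², 1) × B_{λ^k}` and the geometric series
  `Σ_k λ^{-2k} λ^{3k/10}` along the scaling). `IsAnsatzSolution` therefore carries that printed
  class, as `π ∈ L^{5/3}((1,λ²) × ℝ³)` (one period; `‖π(t)‖_{5/3}^{5/3} = (2t)^{-1/6} ‖p(s)‖_{5/3}^{5/3}`).
* *Everywhere in `t`.* The `L^∞(1,λ²;L²)` bound is stated for every `t ∈ [1, λ²]` (print:
  "`sup_{1≤τ≤λ²}`", and the `t^{1/4}` estimate "for any `t ∈ (0,∞)`"; the constructed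
  `U = u − U₀` is a weak `L²`-limit "for all `s ∈ [0,T]`", proof of Thm 2.4), which is what the
  attainment of the datum as a genuine limit `t → 0⁺` in `IsLocalLeraySolution.initial` consumes.
* *Representatives, `t ≤ 0`.* As in `ForwardDSSExistence.lean`: `λ`-DSS is the pointwise identity
  on `ℝ × ℝ³` (extend `v`, `π` by `0` for `t ≤ 0`; no clause sees `t ≤ 0`). The caloric extension
  is the tree's `UnboundedOperators.heatExtension v₀ t = heatKernel t ⋆ v₀` (meaningful for
  `t > 0`; for `v₀ ∈ L³_w ⊂ L²_uloc` the integral converges absolutely).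
* *Hypotheses of `bradshawTsai2017_section4`.* The standing hypotheses of Theorem 1.2 are kept
  verbatim although divergence-freeness is not used by the verification; the fact is true as
  stated (all its conclusions follow from `IsAnsatzSolution`, `v₀ ∈ L³_w ⊂ E²` and standard
  properties of `e^{tΔ}` on `L²_uloc`) and is meant to be discharged.

## Mathlib / tree search

Mathlib (this pin) has no Navier–Stokes, weak-`L^p` or local-Leray notions; used from Mathlib:
`Measure.integral_comp_smul` (via the tree's covariance lemma), `exists_mem_Ico_zpow` (locating
`t` on the scaling orbit of `[1, λ²)`), `lintegral`/`ENNReal` algebra. Reused from the tree (nothing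
redefined): the parent fact and `IsLocalLeraySolution` (`ForwardDSSExistence`,
`LocalLeraySolutions`); `IsSuitableWeakSolutionOn`, `HasWeakSpatialGradientOn`, `frobeniusNormSq`,
`slab` (`SuitableWeak`, `WeakSolution`, `VectorCalculus`); `IsDiscretelySelfSimilar`, `nsRescale*`
(`SelfSimilar`); `MemWeakLp` (`FunctionSpaces/WeakLp`); the caloric extension
`UnboundedOperators.heatExtension` with `heatExtension_zero_fun` (`UnboundedOperators/HeatKernel`,
`HeatKernelHeatEquation`); the parabolic self-similarity of the heat kernel and of the caloric
extension `heatKernel_sq_mul_smul`, `heatExtension_comp_inv_smul` (`SelfSimilarProofs`,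
§HeatKernel — `heatExtension_nsRescaleData` below is its `nsRescaleData` corollary); the DSS algebra
and scaling laws `BradshawTsai2019.isDiscretelySelfSimilar_pow/_inv`,
`setLIntegral_enorm_sub_sq_eq_of_dss` (`ForwardDSSExtension`; `isDiscretelySelfSimilar_zpow` below
is their `ℤ`-generalisation); `isSuitableWeakSolutionOn_zero`, `hasWeakSpatialGradientOn_zero`
(`LocalLeraySolutions`). `lean search 'Ansatz|periodic weak|Leray system|L3w.*heat'`: no prior
rendering of [BT1] §2–§4.

## References

* Z. Bradshaw, T.-P. Tsai, *Forward discretely self-similar solutions of the Navier–Stokes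
  equations II*, Ann. Henri Poincaré 18 (2017) 1095–1119 = arXiv:1510.07504: §1 (Def. 1.1,
  Thm 1.2, the ansatz `v = u(y,s)/√(2t)`); (2.1), Assumption 2.1, Def. 2.2, Def. 2.3, Thm 2.4
  and its proof (pressure estimate,
  "`p ∈ L^{5/3}(ℝ³ × [0,T])`"); Lemma 3.4 and its proof; §4 (proof of Thm 1.2) [BradshawTsai2017AHP].
* K. Kang, H. Miura, T.-P. Tsai, IMRN 2021, Def. 3.2 (`IsLocalLeraySolution`) [KangMiuraTsai2020].
* L. C. Evans, *Partial differential equations*, §2.3.1 (heat kernel) [Evans2010].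
-/

noncomputable section

open MeasureTheory Set Function Filter Topology TopologicalSpace Metric Module
open scoped NNReal ENNReal InnerProductSpace RealInnerProductSpace

namespace Literature.Analysis.FluidPDE

/-- Local notation for physical space `ℝ³ = EuclideanSpace ℝ (Fin 3)`. -/
local notation "ℝ³" => EuclideanSpace ℝ (Fin 3)

namespace BradshawTsai2017

/-! ## Parabolic scaling of the heat kernel and of the caloric extension -/

section HeatScaling

variable {E : Type*} [NormedAddCommGroup E] [InnerProductSpace ℝ E]
variable {F : Type*} [NormedAddCommGroup F] [NormedSpace ℝ F]

/-- A `λ`-DSS field is `λᵏ`-DSS for every `k ∈ ℤ` (`λ ≠ 0`; [BT1] §1: "`λ`-DSS solutions are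
decided by their behavior on the time interval `1 ≤ t ≤ λ²`"). [folklore] -/
theorem isDiscretelySelfSimilar_zpow {c : ℝ} (hc : c ≠ 0) {u : ℝ → E → F}
    (h : FluidPDE.IsDiscretelySelfSimilar c u) (k : ℤ) :
    FluidPDE.IsDiscretelySelfSimilar (c ^ k) u := by
  obtain ⟨m, rfl | rfl⟩ := k.eq_nat_or_neg
  · rw [zpow_natCast]
    exact BradshawTsai2019.isDiscretelySelfSimilar_pow h m
  · rw [zpow_neg, zpow_natCast]
    exact BradshawTsai2019.isDiscretelySelfSimilar_inv (pow_ne_zero _ hc)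
      (BradshawTsai2019.isDiscretelySelfSimilar_pow h m)

variable [FiniteDimensional ℝ E] [MeasurableSpace E] [BorelSpace E]

/-- **DSS covariance of the caloric extension**: rescaling the datum rescales the heat flow,
`e^{tΔ}(λ v₀(λ·))(x) = λ (e^{λ²tΔ}v₀)(λx)` for `λ, t > 0`; [BT1], proof of Lemma 3.4: "Since `v₀`
is divergence free and `λ`-DSS, `e^{tΔ}v₀` is the divergence free, `λ`-DSS solution to the heat
equation". This is the `nsRescaleData` form (the one the `t^{1/4}`-estimate consumes) of the
accepted covariance `heatExtension_comp_inv_smul` (`SelfSimilarProofs`, applied with `λ⁻¹` at time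
`λ²t`), combined with linearity of the Gauss–Weierstrass integral in the datum. Valid for every
`v₀ : E → F` (both sides are the junk `0` together when the integrals diverge). [cite: BradshawTsai2017AHP, proof of Lemma 3.4] -/
theorem heatExtension_nsRescaleData {c : ℝ} (hc : 0 < c) (v₀ : E → F) {t : ℝ} (ht : 0 < t)
    (x : E) :
    UnboundedOperators.heatExtension (FluidPDE.nsRescaleData c v₀) t x =
      c • UnboundedOperators.heatExtension v₀ (c ^ 2 * t) (c • x) := by
  have key := heatExtension_comp_inv_smul (inv_pos.2 hc) v₀ (mul_pos (pow_pos hc 2) ht) x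
  rw [inv_inv, show c⁻¹ ^ 2 * (c ^ 2 * t) = t by field_simp] at key
  rw [← key, UnboundedOperators.heatExtension_apply, UnboundedOperators.heatExtension_apply,
    ← integral_smul]
  refine integral_congr_ae (Eventually.of_forall fun y => ?_)
  simp only [FluidPDE.nsRescaleData_apply]
  rw [smul_comm]

/-- The caloric extension of a `λ`-DSS datum is `λ`-DSS on `t > 0`:
`λ (e^{λ²tΔ}v₀)(λx) = (e^{tΔ}v₀)(x)` ([BT1], proof of Lemma 3.4). [cite: BradshawTsai2017AHP, proof of Lemma 3.4] -/
theorem heatExtension_dss {c : ℝ} (hc : 0 < c) {v₀ : E → F}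
    (hv₀ : FluidPDE.nsRescaleData c v₀ = v₀) {t : ℝ} (ht : 0 < t) (x : E) :
    c • UnboundedOperators.heatExtension v₀ (c ^ 2 * t) (c • x) =
      UnboundedOperators.heatExtension v₀ t x := by
  rw [← heatExtension_nsRescaleData hc v₀ ht x, hv₀]

end HeatScaling

/-! ## The physical-variables image of a suitable periodic weak solution -/

/-- **The ansatz pair of [BT1] §4** for the scaling factor `c = λ`, the datum `v₀` and a pair
`(v, π)`: what the proof of Theorem 1.2 has in hand after its first three paragraphs, i.e. the
image `v(x,t) = u(y,s)/√(2t)`, `π(x,t) = p(y,s)/(2t)` (`y = x/√(2t)`, `s = log √(2t)`, the ansatz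
of §1) of a suitable periodic weak solution `(u, p)` (Def. 2.3, from Thm 2.4) of the
time-periodic Leray system (2.1) with
profile `U₀ = √(2t) e^{tΔ}v₀` (Lemma 3.4), written in the physical variables:
`v` is `λ`-DSS and `π` is a `λ`-DSS pressure (`T`-periodicity of `(u,p)`, `T = log λ`); `(v, π)` is
a suitable weak solution of (NSE) on `(0,∞) × ℝ³` ("`(v,π)` is a distributional solution to (NSE)"
and "Local energy inequality: … inherited from the suitability of `(u,p)`", with the local classes
of Def. 2.2–2.3); "`v − e^{tΔ}v₀ ∈ L^∞(1,λ²;L²(ℝ³)) ∩ L²(1,λ²;H¹(ℝ³))`" (from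
`u − U₀ ∈ L^∞(0,T;L²) ∩ L²(0,T;H¹)`, Def. 2.2; the `L^∞` bound for every `t ∈ [1,λ²]`, see the
module docstring); and `π ∈ L^{5/3}((1,λ²) × ℝ³)` ("`p ∈ L^{5/3}(ℝ³ × [0,T])`", proof of Thm 2.4).
The caloric extension `e^{tΔ}v₀` is `UnboundedOperators.heatExtension v₀ t`. [cite: BradshawTsai2017AHP, §4 (proof of Thm 1.2) with Def. 2.2–2.3] -/
structure IsAnsatzSolution (c : ℝ) (v₀ : ℝ³ → ℝ³) (v : ℝ → ℝ³ → ℝ³) (π : ℝ → ℝ³ → ℝ) :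
    Prop where
  /-- `v` is `λ`-DSS: `λ v(λ²t, λx) = v(t, x)` on `ℝ × ℝ³`. -/
  dss : FluidPDE.IsDiscretelySelfSimilar c v
  /-- `π` is a `λ`-DSS pressure: `λ² π(λ²t, λx) = π(t, x)` on `ℝ × ℝ³`. -/
  dss_pressure : FluidPDE.nsRescalePressure c π = π
  /-- `(v, π)` is a suitable weak solution of Navier–Stokes (`ν = 1`, `f = 0`) on the open slab
  `(0, ∞) × ℝ³` (distributional solution, local energy classes, CKN inequality). -/
  suitable : FluidPDE.IsSuitableWeakSolutionOn (FluidPDE.slab ℝ³ (Ioi 0) isOpen_Ioi) 1 0 v π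
  /-- `sup_{1 ≤ t ≤ λ²} ‖v(t) − e^{tΔ}v₀‖²_{L²(ℝ³)} < ∞`, for EVERY `t ∈ [1, λ²]` (deliberately not
  `∀ᵐ t` as in the sibling facts: see the module docstring, "Everywhere in `t`"). -/
  energy_sub_heat : ∃ C : ℝ≥0, ∀ t ∈ Icc (1 : ℝ) (c ^ 2),
    ∫⁻ x, ‖v t x - UnboundedOperators.heatExtension v₀ t x‖ₑ ^ 2 ≤ C
  /-- `∇(v − e^{tΔ}v₀) ∈ L²((1, λ²) × ℝ³)`: a weak spatial gradient `G` of `v − e^{tΔ}v₀` on the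
  slab, square integrable on `(1, λ²) × ℝ³`. -/
  gradient_sub_heat : ∃ G : ℝ → ℝ³ → ℝ³ →L[ℝ] ℝ³,
    FluidPDE.HasWeakSpatialGradientOn (FluidPDE.slab ℝ³ (Ioi 0) isOpen_Ioi)
      (fun t x => v t x - UnboundedOperators.heatExtension v₀ t x) G ∧
    ∫⁻ z in Ioo (1 : ℝ) (c ^ 2) ×ˢ (univ : Set ℝ³),
      ENNReal.ofReal (FluidPDE.frobeniusNormSq (G z.1 z.2)) < ⊤
  /-- `π ∈ L^{5/3}((1, λ²) × ℝ³)`. -/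
  pressure_five_thirds :
    ∫⁻ z in Ioo (1 : ℝ) (c ^ 2) ×ˢ (univ : Set ℝ³), ‖π z.1 z.2‖ₑ ^ (5 / 3 : ℝ) < ⊤

/-- **Non-vacuity.** For the zero datum the trivial pair `(0, 0)` is an ansatz pair (every
quantity vanishes; `e^{tΔ}0 = 0` is the accepted `UnboundedOperators.heatExtension_zero_fun`). [folklore] -/
theorem isAnsatzSolution_zero (c : ℝ) :
    IsAnsatzSolution c (0 : ℝ³ → ℝ³) (0 : ℝ → ℝ³ → ℝ³) (0 : ℝ → ℝ³ → ℝ) where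
  dss := by funext t x; simp
  dss_pressure := by funext t x; simp
  suitable := isSuitableWeakSolutionOn_zero _ 1
  energy_sub_heat := ⟨0, fun t _ => by
    simp [show UnboundedOperators.heatExtension (0 : ℝ³ → ℝ³) t = 0 from
      UnboundedOperators.heatExtension_zero_fun t]⟩
  gradient_sub_heat := by
    refine ⟨0, ?_, by simp [frobeniusNormSq_zero]⟩
    have h0 : (fun t x => (0 : ℝ → ℝ³ → ℝ³) t x -
        UnboundedOperators.heatExtension (0 : ℝ³ → ℝ³) t x) = 0 := by
      funext t x
      simp [show UnboundedOperators.heatExtension (0 : ℝ³ → ℝ³) t = 0 from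
        UnboundedOperators.heatExtension_zero_fun t]
    rw [h0]
    exact hasWeakSpatialGradientOn_zero _
  pressure_five_thirds := by
    simp only [Pi.zero_apply, enorm_zero]
    rw [ENNReal.zero_rpow_of_pos (by norm_num)]
    simp

/-- **The `t^{1/4}`-estimate of [BT1] Thm 1.2** from the bound on one period: if `(v, π)` is an
ansatz pair for the `λ`-DSS datum `v₀` (`λ > 1`), then
`‖v(t) − e^{tΔ}v₀‖²_{L²(ℝ³)} ≤ C √t` for every `t > 0` (§4: "The `λ`-DSS scaling property implies
`‖v(t) − e^{tΔ}v₀‖²_{L²} ≲ t^{1/2} sup_{1≤τ≤λ²} ‖v(τ) − e^{τΔ}v₀‖²_{L²}`": `v − e^{tΔ}v₀` is `λ`-DSS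
on `t > 0` by `heatExtension_dss`, and `∫|w(t)|² = γ ∫|w(γ⁻²t)|²` for `γ = λᵏ ≤ √t` with
`γ⁻²t ∈ [1, λ²)`). [cite: BradshawTsai2017AHP, Thm 1.2 and §4] -/
theorem IsAnsatzSolution.lintegral_enorm_sub_heat_sq_le {c : ℝ} {v₀ : ℝ³ → ℝ³}
    {v : ℝ → ℝ³ → ℝ³} {π : ℝ → ℝ³ → ℝ} (h : IsAnsatzSolution c v₀ v π) (hc : 1 < c)
    (hv₀ : FluidPDE.nsRescaleData c v₀ = v₀) :
    ∃ C : ℝ≥0, ∀ t : ℝ, 0 < t →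
      ∫⁻ x, ‖v t x - UnboundedOperators.heatExtension v₀ t x‖ₑ ^ 2 ≤
        C * ENNReal.ofReal (Real.sqrt t) := by
  have hc0 : 0 < c := zero_lt_one.trans hc
  obtain ⟨C, hC⟩ := h.energy_sub_heat
  refine ⟨C, fun t ht => ?_⟩
  -- the difference, extended by zero to `t ≤ 0`, is `λ`-DSS on all of `ℝ × ℝ³`
  set w : ℝ → ℝ³ → ℝ³ := fun s x =>
    if 0 < s then v s x - UnboundedOperators.heatExtension v₀ s x else 0 with hw
  have hwdss : FluidPDE.IsDiscretelySelfSimilar c w := by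
    funext s x
    rw [FluidPDE.nsRescale_apply]
    by_cases hs : 0 < s
    · have hs' : 0 < c ^ 2 * s := mul_pos (pow_pos hc0 2) hs
      simp only [hw, if_pos hs, if_pos hs', smul_sub]
      rw [heatExtension_dss hc0 hv₀ hs]
      have := congrFun (congrFun h.dss s) x
      rw [FluidPDE.nsRescale_apply] at this
      rw [this]
    · have hs' : ¬ 0 < c ^ 2 * s := fun h' => hs (pos_of_mul_pos_right h' (sq_nonneg c))
      simp only [hw, if_neg hs, if_neg hs', smul_zero]
  -- locate `t` on the scaling orbit of `[1, λ²)`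
  obtain ⟨k, hk1, hk2⟩ := exists_mem_Ico_zpow ht (one_lt_pow₀ hc two_ne_zero)
  set γ : ℝ := c ^ k with hγ
  have hγ0 : 0 < γ := zpow_pos hc0 k
  have hγ2 : (c ^ 2) ^ k = γ ^ 2 := by rw [hγ, ← zpow_natCast, ← zpow_natCast, zpow_comm]
  rw [hγ2] at hk1
  rw [zpow_add_one₀ (pow_ne_zero 2 hc0.ne'), hγ2] at hk2
  have hγu : FluidPDE.IsDiscretelySelfSimilar γ w := isDiscretelySelfSimilar_zpow hc0.ne' hwdss k
  have h0 : FluidPDE.nsRescaleData γ (0 : ℝ³ → ℝ³) = 0 := by funext x; simp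
  have key := BradshawTsai2019.setLIntegral_enorm_sub_sq_eq_of_dss hγ0 hγu h0 univ t
  simp only [Pi.zero_apply, sub_zero, preimage_univ, Measure.restrict_univ,
    finrank_euclideanSpace_fin] at key
  -- the rescaled time `γ⁻² t` lies in `[1, λ²]`
  have hs1 : 1 ≤ (γ ^ 2)⁻¹ * t := by
    rw [le_inv_mul_iff₀ (pow_pos hγ0 2), mul_one]; exact hk1
  have hs2 : (γ ^ 2)⁻¹ * t ≤ c ^ 2 := by
    rw [inv_mul_le_iff₀ (pow_pos hγ0 2)]; exact hk2.le
  have hspos : 0 < (γ ^ 2)⁻¹ * t := lt_of_lt_of_le zero_lt_one hs1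
  have hwt : ∀ x, w t x = v t x - UnboundedOperators.heatExtension v₀ t x := fun x => by
    simp only [hw, if_pos ht]
  have hws : ∀ x, w ((γ ^ 2)⁻¹ * t) x = v ((γ ^ 2)⁻¹ * t) x -
      UnboundedOperators.heatExtension v₀ ((γ ^ 2)⁻¹ * t) x := fun x => by
    simp only [hw, if_pos hspos]
  simp_rw [hwt, hws] at key
  rw [key]
  -- `γ³ · γ⁻² = γ ≤ √t`
  have hconst : ENNReal.ofReal (γ ^ 3) * ENNReal.ofReal γ⁻¹ ^ 2 = ENNReal.ofReal γ := by
    rw [← ENNReal.ofReal_pow (inv_nonneg.2 hγ0.le), ← ENNReal.ofReal_mul (by positivity)]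
    congr 1
    field_simp
  have hγt : γ ≤ Real.sqrt t := Real.le_sqrt_of_sq_le hk1
  rw [hconst, mul_comm]
  exact mul_le_mul' (hC _ ⟨hs1, hs2⟩) (ENNReal.ofReal_le_ofReal hγt)

end BradshawTsai2017

/-! ## The two printed ingredients -/

/-- **Bradshaw–Tsai 2017, Theorem 2.4 with Lemma 3.4** (existence of suitable periodic weak
solutions of the time-periodic Leray system with the profile of a DSS datum), in the physical
variables of §4: "Theorem 2.4. Assume `U₀(y,s)` satisfies Assumption 2.1 with `q = 10/3`. Then
(2.1) has a periodic suitable weak solution `(u,p)` in `ℝ⁴` with period `T`" [proof: Galerkin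
approximation of the mollified perturbed Leray system (Lemmas 2.5–2.6, Brouwer's fixed point
theorem for the period map), limits `k → ∞`, `ε → 0`, pressure by Riesz transforms with
"`p ∈ L^{5/3}(ℝ³ × [0,T])`", suitability "as in [CKN]"]; "Lemma 3.4. Suppose `v₀` satisfies the
assumptions of Theorem 1.2 … Then `U₀(y,s) = √(2t) (e^{tΔ}v₀)(x)` satisfies Assumption 2.1 with
`T = log λ` and any `q ∈ (3,∞]`"; §4 ¶1–3: with `v(x,t) = u(y,s)/√(2t)`, `π(x,t) = p(y,s)/2t`,
"`(v,π)` is a distributional solution to (NSE) … `v − e^{tΔ}v₀ ∈ L^∞(1,λ²;L²(ℝ³)) ∩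
L²(1,λ²;H¹(ℝ³))`" and the local energy inequality for `(v,π)` is "inherited from the suitability
of `(u,p)`". Rendered: every divergence free `λ`-DSS `v₀ ∈ L³_w(ℝ³)` (`λ > 1`) admits a pair
`(v, π)` with `BradshawTsai2017.IsAnsatzSolution λ v₀ v π`. [cite: BradshawTsai2017AHP, Thm 2.4 with Lemma 3.4 and §4 ¶1–3] -/
def bradshawTsai2017_thm_2_4 : Prop :=
  ∀ {c : ℝ}, 1 < c → ∀ {v₀ : ℝ³ → ℝ³}, FunctionSpaces.MemWeakLp v₀ 3 volume →
    FluidPDE.IsWeaklyDivFree v₀ → FluidPDE.nsRescaleData c v₀ = v₀ →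
    ∃ (v : ℝ → ℝ³ → ℝ³) (π : ℝ → ℝ³ → ℝ), BradshawTsai2017.IsAnsatzSolution c v₀ v π

/-- **Bradshaw–Tsai 2017, §4 (proof of Theorem 1.2): verification of the local Leray axioms.**
"It follows that `v − e^{tΔ}v₀ ∈ L^∞(0,λ²;L²(ℝ³)) ∩ L²(0,λ²;H¹(ℝ³))` [(4.1)]. We now check that
`v` is a local Leray solution to (NSE). *Locally finite energy and enstrophy:* This follows from
inequality [(4.1)] noting that `v₀ ∈ L²_uloc` implies `e^{tΔ}v₀` has uniformly locally finite energy
and enstrophy. *Convergence to initial data:* The fact that `‖v(t) − e^{tΔ}v₀‖_{L²(ℝ³)} ≲ t^{1/4}`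
implies convergence to zero in the `L²_loc(ℝ³)` norm … `e^{tΔ}v₀ → v₀` in `L²_loc(ℝ³)` as
`t → 0⁺` … *Decay at spatial infinity:* … `lim_{|x₀|→∞} ∫₀^{R²}∫_{B_R(x₀)} |v|² dx dt = 0`.
*Local energy inequality:* This property for `(v,π)` is inherited from the suitability of
`(u,p)`." Rendered as the implication it proves: for a divergence free `λ`-DSS `v₀ ∈ L³_w(ℝ³)`
(`λ > 1`), every ansatz pair `(v, π)` (`BradshawTsai2017.IsAnsatzSolution λ v₀ v π`) is a local
Leray solution with datum `v₀` in the sense of [BT1] Def. 1.1 = `IsLocalLeraySolution 1 v₀ v π`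
(including `π ∈ L^{3/2}_loc(ℝ³ × [0,∞))`, see the module docstring, "The pressure class"). True as
stated and dischargeable from heat-semigroup estimates on `L²_uloc`. [cite: BradshawTsai2017AHP, §4 (proof of Thm 1.2)] -/
def bradshawTsai2017_section4 : Prop :=
  ∀ {c : ℝ}, 1 < c → ∀ {v₀ : ℝ³ → ℝ³}, FunctionSpaces.MemWeakLp v₀ 3 volume →
    FluidPDE.IsWeaklyDivFree v₀ → FluidPDE.nsRescaleData c v₀ = v₀ →
    ∀ {v : ℝ → ℝ³ → ℝ³} {π : ℝ → ℝ³ → ℝ}, BradshawTsai2017.IsAnsatzSolution c v₀ v π →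
      IsLocalLeraySolution 1 v₀ v π

/-! ## The assembly: Thm 2.4 (with Lemma 3.4) + §4 ⟹ Theorem 1.2 -/

/-- **Assembly of [BT1] Theorem 1.2 from its printed ingredients** (§4): for an admissible datum
take the ansatz pair of Theorem 2.4 (with Lemma 3.4); by §4 it is a local Leray solution, and it
is `λ`-DSS by construction. Hence the trust base of `bradshawTsai2017_dss_localLeray_existence` is
`{bradshawTsai2017_thm_2_4, bradshawTsai2017_section4}`. [cite: BradshawTsai2017AHP, §4 (proof of Thm 1.2)] -/
theorem bradshawTsai2017_dss_localLeray_existence_of_parts (h24 : bradshawTsai2017_thm_2_4)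
    (h4 : bradshawTsai2017_section4) : bradshawTsai2017_dss_localLeray_existence := by
  intro c hc v₀ hw hdiv hdss
  obtain ⟨v, π, hA⟩ := h24 hc hw hdiv hdss
  exact ⟨v, π, h4 hc hw hdiv hdss hA, hA.dss⟩

/-- The assembled solution also obeys the printed `t^{1/4}`-estimate: under the two ingredients,
every admissible datum has a `λ`-DSS local Leray solution `(v, π)` with
`‖v(t) − e^{tΔ}v₀‖²_{L²(ℝ³)} ≤ C √t` for all `t > 0` ([BT1] Thm 1.2, full conclusion). [cite: BradshawTsai2017AHP, Thm 1.2] -/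
theorem bradshawTsai2017_thm_1_2_of_parts (h24 : bradshawTsai2017_thm_2_4)
    (h4 : bradshawTsai2017_section4) {c : ℝ} (hc : 1 < c) {v₀ : ℝ³ → ℝ³}
    (hw : FunctionSpaces.MemWeakLp v₀ 3 volume) (hdiv : FluidPDE.IsWeaklyDivFree v₀)
    (hdss : FluidPDE.nsRescaleData c v₀ = v₀) :
    ∃ (v : ℝ → ℝ³ → ℝ³) (π : ℝ → ℝ³ → ℝ), IsLocalLeraySolution 1 v₀ v π ∧
      FluidPDE.IsDiscretelySelfSimilar c v ∧
      ∃ C : ℝ≥0, ∀ t : ℝ, 0 < t →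
        ∫⁻ x, ‖v t x - UnboundedOperators.heatExtension v₀ t x‖ₑ ^ 2 ≤
          C * ENNReal.ofReal (Real.sqrt t) := by
  obtain ⟨v, π, hA⟩ := h24 hc hw hdiv hdss
  exact ⟨v, π, h4 hc hw hdiv hdss hA, hA.dss, hA.lintegral_enorm_sub_heat_sq_le hc hdss⟩

end Literature.Analysis.FluidPDE

end
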